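import Summits.Ventures.HodgeRepro.TwistedQuadAllPos
import Summits.Ventures.HodgeRepro.TwistedQuadAllNeg

/-!
# The general-`k` twisted rectangles on the model groups themselves

Blind re-derivation cell `pub-hodge-repro`, seat `p1` (gen 12).  `TwistedQuadAllPos` / `TwistedQuadAllNeg` prove
route-2's Theorem T (i) for every even `k = 2j ≥ 4` in every ambient `(G, c)`; this file checks that their hypotheses
are met on the model groups `ℤ/4j ⋊ ℤ/2` themselves for EVERY `j ≥ 2` (`c = v^{2j}` is a complex conjugation,
`v` has order `4j`, `u` is an involution outside `⟨v⟩` with `u v u⁻¹ = v^{2j±1}`), so that both theorems are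
non-vacuous at every `k` (`exists_twistedRectQuad_pos_on_model`, `exists_twistedRectQuad_neg_on_model`).
-/

set_option autoImplicit false

open Finset Multiplicative
open scoped Pointwise

namespace HodgeRepro.TwistedQuadGen

open HodgeRepro.CosetQuad

variable (j : ℕ) [NeZero j]

omit [NeZero j] in
/-- `v` has order `4j` on every model `ℤ/4j ⋊_s ℤ/2`. -/
theorem orderOf_tv_gen (s : ZMod (4 * j)) (hs : s * s = 1) : orderOf (tv (4 * j) s hs) = 4 * j := by
  rw [tv, orderOf_injective SemidirectProduct.inl SemidirectProduct.inl_injective, orderOf_ofAdd_eq_addOrderOf,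
    ZMod.addOrderOf_one]

omit [NeZero j] in
/-- `vⁿ = mk n 0`. -/
theorem tv_pow (s : ZMod (4 * j)) (hs : s * s = 1) (n : ℕ) :
    tv (4 * j) s hs ^ n = mk (4 * j) s hs ((n : ℕ) : ZMod (4 * j)) 0 := by
  rw [tv, ← map_pow, ← ofAdd_nsmul, nsmul_eq_mul, mul_one]
  rfl

omit [NeZero j] in
/-- `u² = 1` on every model. -/
theorem tu_sq (s : ZMod (4 * j)) (hs : s * s = 1) : tu (4 * j) s hs ^ 2 = 1 := by
  rw [pow_two, tu_eq_mk, mk_mul, mul_zero, add_zero, two_zmod_two, one_eq_mk]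

/-- `u v u⁻¹ = vˢ` on every model. -/
theorem tu_tv_conj (s : ZMod (4 * j)) (hs : s * s = 1) :
    tu (4 * j) s hs * tv (4 * j) s hs * (tu (4 * j) s hs)⁻¹ = tv (4 * j) s hs ^ s.val := by
  rw [tv_pow, ZMod.natCast_zmod_val, tu_inv, tu_eq_mk, tv_eq_mk, mk_mul, mk_mul, val_one_two, pow_one, mul_one,
    zero_add, show (1 + 0 : ZMod 2) = 1 by decide, val_one_two, pow_one, mul_zero, add_zero,
    two_zmod_two]

omit [NeZero j] in
/-- `c = v^{2j}` is a complex conjugation of the model, for `s · 2j = 2j`. -/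
theorem isComplexConj_tc_gen (hj : 1 ≤ j) (s : ZMod (4 * j)) (hs : s * s = 1)
    (hsh : s * ((2 * j : ℕ) : ZMod (4 * j)) = ((2 * j : ℕ) : ZMod (4 * j))) :
    IsComplexConj (tc (4 * j) s hs) := by
  have htc : tc (4 * j) s hs = mk (4 * j) s hs ((2 * j : ℕ) : ZMod (4 * j)) 0 := by
    rw [tc_eq_mk, show (4 * j) / 2 = 2 * j by omega]
  have hhalf : ∀ g : ZMod 2, s ^ g.val * ((2 * j : ℕ) : ZMod (4 * j)) = ((2 * j : ℕ) : ZMod (4 * j)) := by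
    intro g
    rcases (show ∀ y : ZMod 2, y = 0 ∨ y = 1 by decide) g with rfl | rfl
    · rw [ZMod.val_zero, pow_zero, one_mul]
    · rw [val_one_two, pow_one, hsh]
  refine ⟨?_, ?_, ?_⟩
  · rw [htc, one_eq_mk]
    intro h
    have h1 : ((2 * j : ℕ) : ZMod (4 * j)) = 0 := by
      have := congrArg (fun x : TwistGroup (4 * j) s hs => toAdd x.left) h
      simpa [mk] using this
    rw [ZMod.natCast_eq_zero_iff] at h1
    have := Nat.le_of_dvd (by omega) h1
    omega
  · rw [htc, mk_mul, hhalf, ← Nat.cast_add, show 2 * j + 2 * j = 4 * j by ring, ZMod.natCast_self, one_eq_mk,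
      add_zero]
  · intro g
    rw [htc]
    obtain ⟨l, r⟩ := g
    obtain ⟨a, rfl⟩ := ofAdd.surjective l
    obtain ⟨g, rfl⟩ := ofAdd.surjective r
    show mk (4 * j) s hs ((2 * j : ℕ) : ZMod (4 * j)) 0 * mk (4 * j) s hs a g =
      mk (4 * j) s hs a g * mk (4 * j) s hs ((2 * j : ℕ) : ZMod (4 * j)) 0
    rw [mk_mul, mk_mul, hhalf, ZMod.val_zero, pow_zero, one_mul, zero_add, add_zero, add_comm]

/-- The `ε = +` twisted rectangle on the model `ℤ/4j ⋊ ℤ/2` itself, for every `j ≥ 2`. -/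
theorem exists_twistedRectQuad_pos_on_model (hj : 2 ≤ j) :
    ∃ Φ : Finset (TwistGroup (4 * j) (sPos j) (sPos_sq j)), IsCMType (tc (4 * j) (sPos j) (sPos_sq j)) Φ ∧
      SumTwo (fun i => rmul Φ (rectT (4 * j) (sPos j) (sPos_sq j) i)) ∧
      ∀ i k : Fin 4, rmul Φ (rectT (4 * j) (sPos j) (sPos_sq j) k) ≠
        tc (4 * j) (sPos j) (sPos_sq j) • rmul Φ (rectT (4 * j) (sPos j) (sPos_sq j) i) :=
  exists_twistedRectQuad_pos j hj (isComplexConj_tc_gen j (by omega) _ _ (sPos_mul_half j)) _ _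
    (orderOf_tv_gen j _ _) (tu_sq j _ _) (by rw [tu_tv_conj, sPos_val j (by omega)]) (tu_not_mem_zpowers _ _ _)
    (by rw [tv_pow, tc_eq_mk, show (4 * j) / 2 = 2 * j by omega])

/-- The `ε = −` twisted rectangle on the model `ℤ/4j ⋊ ℤ/2` itself, for every `j ≥ 2`. -/
theorem exists_twistedRectQuad_neg_on_model (hj : 2 ≤ j) :
    ∃ Φ : Finset (TwistGroup (4 * j) (sNeg j) (sNeg_sq j)), IsCMType (tc (4 * j) (sNeg j) (sNeg_sq j)) Φ ∧
      SumTwo (fun i => rmul Φ (rectT (4 * j) (sNeg j) (sNeg_sq j) i)) ∧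
      ∀ i k : Fin 4, rmul Φ (rectT (4 * j) (sNeg j) (sNeg_sq j) k) ≠
        tc (4 * j) (sNeg j) (sNeg_sq j) • rmul Φ (rectT (4 * j) (sNeg j) (sNeg_sq j) i) :=
  exists_twistedRectQuad_neg j hj (isComplexConj_tc_gen j (by omega) _ _ (sNeg_mul_half j)) _ _
    (orderOf_tv_gen j _ _) (tu_sq j _ _) (by rw [tu_tv_conj, sNeg_val j (by omega)]) (tu_not_mem_zpowers _ _ _)
    (by rw [tv_pow, tc_eq_mk, show (4 * j) / 2 = 2 * j by omega])

end HodgeRepro.TwistedQuadGen
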